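/-
Copyright: the b2b-balaban T⁴-continuum CRUX team, row NE7b OWNER lineage `t4-ne7b-p1` (gen 124). Project licence.
-/
import Summits.QuantumFields.BalabanUV.T4Continuum.Spine.NE7b.SupZdPerturbedColumn

/-!
# THE PERTURBED RESPONSE IS LIPSCHITZ IN `K` ON `ℤ^d`: with the objects and the merged constants of (222), for every coarse `b₀` and fine `p`
# the response kernels `h_{b₀} = Σ′M(b′,b₀)Ψ_{b′}` and `h^K_{b₀} = Σ′N_K(b′,b₀)Ψ^K_{b′}` converge absolutely and
# `|h^K_{b₀}(p) − h_{b₀}(p)| ≤ (2C_M′θ_N·2C_PK_{δ₀−μ} + c₁·4C_PK_{δ₀−μ}θ)K_{μ−ν}·e^{−ν|blk n p − b₀|₁}` — both terms LINEAR in `ε` (`θ, θ_N ∝ ε`) —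
# the resolvent split `h^K − h = Σ′(N_K − M)Ψ^K + Σ′M(Ψ^K − Ψ)` with (222)'s four bounds and (214)'s no-loss convolution; all of (222) is
# re-exported, so this file is the current ONE-STOP statement of the `H + K` column on `ℤ^d` (row NE7b, node U5c; (214)∕(222) BY NAME; [folklore])

Cell `pub-balaban`, sub-cell `t4`, spine estimate NE7b (`T4WeightBudget.RelWeightBound`; the cell's OWN estimate — NOT PRINTED in
[Bałaban 1983–89], NOT PROVED).  Crux-route work under `Spine/NE7b/` by the row OWNER (`t4-ne7b-p1` gen 124, file (223)) under FREEZE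
(0)'s crux-prover clause; NOTHING of Bałaban's is named as a Lean object, valued or asserted; no `T4Continuum/Support` leaf typed; no `def`,
no notation (`h_{b₀}`, `h^K_{b₀}`, `θ`, `θ_N`, `C_M′`, `C_PK_{δ₀−μ}` WRITTEN OUT); zero `sorry`.  Imports (BY NAME): the OWNER's (222)
`…SupZdPerturbedColumn` (`zd_perturbed_column`, `K_pos`; through it (214) `tsum_exp_conv_noLoss`), Mathlib's `Summable.tsum_sub`,
`norm_tsum_le_tsum_norm`.

WHY (located).  § [NE7bP1-G124-HANDOFF] NEXT (3)(b): the relative weight bound compares the renormalised effective actions WITH and WITHOUT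
the small nonlocal part `K`; at the level of the linear column this is the Lipschitz dependence on `K` of the three objects.  (216) (iii)
gave it for the block columns and the coarse entries, (219)∕(222) for the next-scale Hessian `N_K`; this file gives it for the RESPONSE
`D_Ke_{b₀} = h^K_{b₀}` (the minimiser's dependence on the coarse field), pointwise with the block-scale decay `e^{−ν|blk n p − b₀|₁}`: the
split `N_KΨ^K − MΨ = (N_K − M)Ψ^K + M(Ψ^K − Ψ)` is bounded termwise by `(2C_M′θ_N·2C_PK + c₁·4C_PKθ)e^{−μ|blk n p − b′|₁}e^{−ν|b′−b₀|₁}` (using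
`|M(b′,b₀)| ≤ c₁e^{−ν|b′−b₀|₁}` since `ν < δ₁`), and (214) sums the convolution of the two DIFFERENT rates `ν < μ` without loss.

WHAT IS PROVED ([folklore]): §1 **`zd_perturbed_response_lipschitz`** (THE END: `∃ C₀ C_P δ₀ c₁ δ₁ > 0`: for ALL `n, V, ε, γ, μ, ν` with the
three smallness conditions and every `K` of the class: `∃ Ψ Ψ^K M N` with ALL clauses (A)–(C) of (222) AND (D): for every `b₀, p`,
summability of both response series and the `O(ε)` bound on their difference with decay); §2 toy.

HONEST (what this is NOT).  Response only: the Lipschitz dependence of the fluctuation covariance `C_K` ((221)) on `K` is the sequel (same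
split, one more layer); no operator packaging; no symmetry of `N_K`; no torus → `ℤ^d` limit of the `H + K` tower; THREE smallness
conditions with the sup road's constants — NOT (163)'s energy threshold; the LINEAR column only; `d ≥ 3` only; scalar skeleton ((A3),
NC-NE7b-α UNRULED); nothing of the covariant propagators of [B4]–[B6]; nothing of Bałaban's asserted.  BY-NAME EFFECT ON THE WALL: NONE.
NE7b NOT PRINTED ∕ NOT PROVED; spine PROVED 0∕9; rung (B)+1 — the programme's measures remain FINITE-torus statements; NOT the mass gap, NOT
Clay.  HONEST DEPENDENCY: continuum YM on T⁴ ⇐ BetaPertH ∧ nine spine estimates (0∕9 proved); BetaPertH ⇐ (D1) ∧ (D4) ∧ CAP+tail; G-an2-4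
gates asym, D1 and NE2∕3∕4.
-/

set_option autoImplicit false

noncomputable section

namespace Summit.QuantumFields.BalabanUV.T4Continuum.NE7b.SupZdPerturbedResponseLipschitz

open Real Filter Topology
open scoped ENNReal
open Literature.MathematicalPhysics.QuantumFieldTheory.Balaban1983to89
open B6QGQLower276 (X e blk B)
open SupZdProfileNoLoss (tsum_exp_conv_noLoss)
open SupZdPerturbedColumn (K_pos zd_perturbed_column)

variable {d : ℕ}

/-! ## §1. THE END: the perturbed response kernels are `O(ε)`-close to the unperturbed ones, with decay -/

/-- **HEADLINE — THE RESPONSE IS LIPSCHITZ IN `K` ON `ℤ^d`**: with the constants and ALL the clauses of (222) (the `H + K` column's objects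
`Ψ, Ψ^K, M, N_K` on `ℤ^d`, re-exported verbatim), additionally: for every coarse `b₀` and fine `p` the response series
`h_{b₀}(p) = Σ′_{b′}M(b′,b₀)Ψ_{b′}(p)` and `h^K_{b₀}(p) = Σ′_{b′}N_K(b′,b₀)Ψ^K_{b′}(p)` converge absolutely and
`|h^K_{b₀}(p) − h_{b₀}(p)| ≤ (2C_M′θ_N·2C_PK_{δ₀−μ} + c₁·4C_PK_{δ₀−μ}θ)·K_{μ−ν}·e^{−ν|blk n p − b₀|₁}` — BOTH terms `∝ ε` — from
`h^K − h = Σ′(N_K − M)(b′,b₀)Ψ^K_{b′} + Σ′M(b′,b₀)(Ψ^K_{b′} − Ψ_{b′})`, (222)'s `|N_K − M|`, `|Ψ^K|`, `|M|`, `|Ψ^K − Ψ|` bounds, and (214)'s no-loss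
convolution (rates `ν < μ`). [folklore] -/
theorem zd_perturbed_response_lipschitz (hd : 3 ≤ d) (a : ℝ) (ha : 0 < a) {lam Lam : ℝ} (hlam : lam < min 2 a) (hLam : 0 ≤ Lam) :
    ∃ C₀ CP δ₀ c₁ δ₁ : ℝ, 0 < C₀ ∧ 0 < CP ∧ 0 < δ₀ ∧ 0 < c₁ ∧ 0 < δ₁ ∧
    ∀ (n : ℕ) (V : X d → ℝ), (∀ p, -lam ≤ V p) → (∀ p, V p ≤ Lam) →
    ∀ (ε γ μ ν : ℝ), 0 ≤ ε → 0 < μ → μ < δ₀ → μ < γ → 0 < ν → ν < μ → ν < δ₁ →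
      ε * (2 * (1 - exp (-γ))⁻¹) ^ d * C₀ ≤ 1 / 2 →
      (CP * (2 * (1 - exp (-(δ₀ - μ)))⁻¹) ^ d) * (ε * exp (μ * d) * (2 * (1 - exp (-(γ - μ)))⁻¹) ^ d) ≤ 1 / 2 →
      (c₁ * exp (ν * d) * (2 * (1 - exp (-(δ₁ - ν)))⁻¹) ^ d)
        * ((4 * (CP * (2 * (1 - exp (-(δ₀ - μ)))⁻¹) ^ d)
            * ((CP * (2 * (1 - exp (-(δ₀ - μ)))⁻¹) ^ d) * (ε * exp (μ * d) * (2 * (1 - exp (-(γ - μ)))⁻¹) ^ d)))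
          * exp (ν * d) * (2 * (1 - exp (-(μ - ν)))⁻¹) ^ d) ≤ 1 / 2 →
    ∀ (K : X d → X d → ℝ), (∀ p q, |K p q| ≤ ε * exp (-(γ * ∑ i, (((p i - q i).natAbs : ℕ) : ℝ)))) →
    ∃ Ψ ΨK M N : X d → X d → ℝ,
      -- (A) the block columns
      (∀ c p, ((n : ℝ) + 1) ^ 2 * ∑ μ', (2 * Ψ c p - Ψ c (p + e μ') - Ψ c (p - e μ'))
        + a / ((n : ℝ) + 1) ^ d * ∑ q ∈ B n (blk n p), Ψ c q + V p * Ψ c p = if blk n p = c then 1 else 0) ∧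
      (∀ c p, |Ψ c p| ≤ 2 * (CP * (2 * (1 - exp (-(δ₀ - μ)))⁻¹) ^ d) * exp (-(μ * ∑ i, (((blk n p i - c i).natAbs : ℕ) : ℝ)))) ∧
      (∀ c p, ((n : ℝ) + 1) ^ 2 * ∑ μ', (2 * ΨK c p - ΨK c (p + e μ') - ΨK c (p - e μ'))
        + a / ((n : ℝ) + 1) ^ d * ∑ q ∈ B n (blk n p), ΨK c q + V p * ΨK c p + ∑' q : X d, K p q * ΨK c q
          = if blk n p = c then 1 else 0) ∧
      (∀ c p, |ΨK c p| ≤ 2 * (CP * (2 * (1 - exp (-(δ₀ - μ)))⁻¹) ^ d) * exp (-(μ * ∑ i, (((blk n p i - c i).natAbs : ℕ) : ℝ)))) ∧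
      (∀ c p, |ΨK c p - Ψ c p| ≤ 4 * (CP * (2 * (1 - exp (-(δ₀ - μ)))⁻¹) ^ d)
        * ((CP * (2 * (1 - exp (-(δ₀ - μ)))⁻¹) ^ d) * (ε * exp (μ * d) * (2 * (1 - exp (-(γ - μ)))⁻¹) ^ d))
        * exp (-(μ * ∑ i, (((blk n p i - c i).natAbs : ℕ) : ℝ)))) ∧
      (∀ b c, |(((n : ℝ) + 1) ^ d)⁻¹ * ∑ q ∈ B n b, ΨK c q - (((n : ℝ) + 1) ^ d)⁻¹ * ∑ q ∈ B n b, Ψ c q|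
        ≤ 4 * (CP * (2 * (1 - exp (-(δ₀ - μ)))⁻¹) ^ d)
          * ((CP * (2 * (1 - exp (-(δ₀ - μ)))⁻¹) ^ d) * (ε * exp (μ * d) * (2 * (1 - exp (-(γ - μ)))⁻¹) ^ d))
          * exp (-(μ * ∑ i, (((b i - c i).natAbs : ℕ) : ℝ)))) ∧
      -- (B) the inverse of the coarse operator
      (∀ b b' : X d, Tendsto (fun R : ℕ =>
        if h : b ∈ (Fintype.piFinset fun _ : Fin d => Finset.Icc (-(R : ℤ)) R) ∧
            b' ∈ (Fintype.piFinset fun _ : Fin d => Finset.Icc (-(R : ℤ)) R)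
          then (Matrix.of fun c c' : ↥(Fintype.piFinset fun _ : Fin d => Finset.Icc (-(R : ℤ)) R) =>
            (((n : ℝ) + 1) ^ d)⁻¹ * ∑ q ∈ B n (c : X d), Ψ (c' : X d) q)⁻¹ ⟨b, h.1⟩ ⟨b', h.2⟩ else 0)
        atTop (𝓝 (M b b'))) ∧
      (∀ b c, |M b c| ≤ c₁ * exp (-(δ₁ * ∑ i, (((b i - c i).natAbs : ℕ) : ℝ)))) ∧
      (∀ b c, M b c = M c b) ∧
      (∀ b c, ∑' b' : X d, ((((n : ℝ) + 1) ^ d)⁻¹ * ∑ q ∈ B n b, Ψ b' q) * M b' c = if b = c then 1 else 0) ∧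
      (∀ b c, ∑' b' : X d, M b b' * ((((n : ℝ) + 1) ^ d)⁻¹ * ∑ q ∈ B n b', Ψ c q) = if b = c then 1 else 0) ∧
      -- (C) the inverse of the perturbed coarse operator
      (∀ b c, |N b c| ≤ 2 * (c₁ * exp (ν * d) * (2 * (1 - exp (-(δ₁ - ν)))⁻¹) ^ d) * exp (-(ν * ∑ i, (((b i - c i).natAbs : ℕ) : ℝ)))) ∧
      (∀ b c, Summable (fun b' : X d => ((((n : ℝ) + 1) ^ d)⁻¹ * ∑ q ∈ B n b, ΨK b' q) * N b' c) ∧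
        ∑' b' : X d, ((((n : ℝ) + 1) ^ d)⁻¹ * ∑ q ∈ B n b, ΨK b' q) * N b' c = if b = c then 1 else 0) ∧
      (∀ b c, Summable (fun b' : X d => N b b' * ((((n : ℝ) + 1) ^ d)⁻¹ * ∑ q ∈ B n b', ΨK c q)) ∧
        ∑' b' : X d, N b b' * ((((n : ℝ) + 1) ^ d)⁻¹ * ∑ q ∈ B n b', ΨK c q) = if b = c then 1 else 0) ∧
      (∀ b c, |N b c - M b c| ≤ 2 * (c₁ * exp (ν * d) * (2 * (1 - exp (-(δ₁ - ν)))⁻¹) ^ d)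
        * ((c₁ * exp (ν * d) * (2 * (1 - exp (-(δ₁ - ν)))⁻¹) ^ d)
          * ((4 * (CP * (2 * (1 - exp (-(δ₀ - μ)))⁻¹) ^ d)
              * ((CP * (2 * (1 - exp (-(δ₀ - μ)))⁻¹) ^ d) * (ε * exp (μ * d) * (2 * (1 - exp (-(γ - μ)))⁻¹) ^ d)))
            * exp (ν * d) * (2 * (1 - exp (-(μ - ν)))⁻¹) ^ d))
        * exp (-(ν * ∑ i, (((b i - c i).natAbs : ℕ) : ℝ)))) ∧
      (∀ (N' : X d → X d → ℝ) (C' ν' : ℝ), 0 ≤ C' → 0 < ν' →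
        (∀ b c, |N' b c| ≤ C' * exp (-(ν' * ∑ i, (((b i - c i).natAbs : ℕ) : ℝ)))) →
        ((∀ b c, ∑' b' : X d, ((((n : ℝ) + 1) ^ d)⁻¹ * ∑ q ∈ B n b, ΨK b' q) * N' b' c = if b = c then 1 else 0) →
          ∀ b c, N' b c = N b c) ∧
        ((∀ b c, ∑' b' : X d, N' b b' * ((((n : ℝ) + 1) ^ d)⁻¹ * ∑ q ∈ B n b', ΨK c q) = if b = c then 1 else 0) →
          ∀ b c, N' b c = N b c)) ∧
      -- (D) the response kernels are Lipschitz in `K`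
      (∀ (b₀ p : X d),
        Summable (fun b' : X d => M b' b₀ * Ψ b' p) ∧ Summable (fun b' : X d => N b' b₀ * ΨK b' p) ∧
        |∑' b' : X d, N b' b₀ * ΨK b' p - ∑' b' : X d, M b' b₀ * Ψ b' p|
          ≤ (2 * (c₁ * exp (ν * d) * (2 * (1 - exp (-(δ₁ - ν)))⁻¹) ^ d)
                * ((c₁ * exp (ν * d) * (2 * (1 - exp (-(δ₁ - ν)))⁻¹) ^ d)
                  * ((4 * (CP * (2 * (1 - exp (-(δ₀ - μ)))⁻¹) ^ d)
                      * ((CP * (2 * (1 - exp (-(δ₀ - μ)))⁻¹) ^ d) * (ε * exp (μ * d) * (2 * (1 - exp (-(γ - μ)))⁻¹) ^ d)))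
                    * exp (ν * d) * (2 * (1 - exp (-(μ - ν)))⁻¹) ^ d))
                * (2 * (CP * (2 * (1 - exp (-(δ₀ - μ)))⁻¹) ^ d))
              + c₁ * (4 * (CP * (2 * (1 - exp (-(δ₀ - μ)))⁻¹) ^ d)
                * ((CP * (2 * (1 - exp (-(δ₀ - μ)))⁻¹) ^ d) * (ε * exp (μ * d) * (2 * (1 - exp (-(γ - μ)))⁻¹) ^ d))))
            * (2 * (1 - exp (-(μ - ν)))⁻¹) ^ d * exp (-(ν * ∑ i, (((blk n p i - b₀ i).natAbs : ℕ) : ℝ)))) := by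
  classical
  obtain ⟨C₀, CP, δ₀, c₁, δ₁, hC₀, hCP, hδ₀, hc₁, hδ₁, H222⟩ := zd_perturbed_column (d := d) hd a ha hlam hLam
  refine ⟨C₀, CP, δ₀, c₁, δ₁, hC₀, hCP, hδ₀, hc₁, hδ₁, ?_⟩
  intro n V hV hV' ε γ μ ν hε hμ hμδ hμγ hν hνμ hνδ hsmall1 hsmall2 hsmall3 K hK
  obtain ⟨Ψ, ΨK, M, N, hA1, hA2, hA3, hA4, hA5, hA6, hB1, hB2, hB3, hB4, hB5, hC1, hC2, hC3, hC4, hC5⟩ :=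
    H222 n V hV hV' ε γ μ ν hε hμ hμδ hμγ hν hνμ hνδ hsmall1 hsmall2 hsmall3 K hK
  refine ⟨Ψ, ΨK, M, N, hA1, hA2, hA3, hA4, hA5, hA6, hB1, hB2, hB3, hB4, hB5, hC1, hC2, hC3, hC4, hC5, fun b₀ p => ?_⟩
  -- names for the composite constants
  have hK0 : 0 < (2 * (1 - exp (-(δ₀ - μ)))⁻¹) ^ d := K_pos (d := d) (sub_pos.2 hμδ)
  have hK1 : 0 < (2 * (1 - exp (-(δ₁ - ν)))⁻¹) ^ d := K_pos (d := d) (sub_pos.2 hνδ)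
  have hKγμ : 0 < (2 * (1 - exp (-(γ - μ)))⁻¹) ^ d := K_pos (d := d) (sub_pos.2 hμγ)
  have hKμν : 0 < (2 * (1 - exp (-(μ - ν)))⁻¹) ^ d := K_pos (d := d) (sub_pos.2 hνμ)
  obtain ⟨CPK, hCPK⟩ : ∃ CPK : ℝ, CPK = CP * (2 * (1 - exp (-(δ₀ - μ)))⁻¹) ^ d := ⟨_, rfl⟩
  obtain ⟨Y, hY⟩ : ∃ Y : ℝ, Y = ε * exp (μ * d) * (2 * (1 - exp (-(γ - μ)))⁻¹) ^ d := ⟨_, rfl⟩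
  obtain ⟨CM, hCM⟩ : ∃ CM : ℝ, CM = c₁ * exp (ν * d) * (2 * (1 - exp (-(δ₁ - ν)))⁻¹) ^ d := ⟨_, rfl⟩
  obtain ⟨TN, hTN⟩ : ∃ TN : ℝ, TN = CM * (4 * CPK * (CPK * Y) * exp (ν * d) * (2 * (1 - exp (-(μ - ν)))⁻¹) ^ d) := ⟨_, rfl⟩
  have hCPK0 : 0 ≤ CPK := by rw [hCPK]; positivity
  have hY0 : 0 ≤ Y := by rw [hY]; positivity
  have hCM0 : 0 ≤ CM := by rw [hCM]; positivity
  have hTN0 : 0 ≤ TN := by rw [hTN]; positivity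
  rw [← hCPK] at hA2 hA4
  rw [← hCPK, ← hY] at hA5
  rw [← hCM] at hC1
  rw [← hCPK, ← hY, ← hCM, ← hTN] at hC4
  rw [← hCPK, ← hY, ← hCM, ← hTN]
  -- the four bounds, at rate `ν` for the coarse variable
  have hS0 : ∀ b' : X d, (0 : ℝ) ≤ ∑ i, (((b' i - b₀ i).natAbs : ℕ) : ℝ) := fun b' => by positivity
  have hMν : ∀ b', |M b' b₀| ≤ c₁ * exp (-(ν * ∑ i, (((b' i - b₀ i).natAbs : ℕ) : ℝ))) := fun b' =>
    (hB2 b' b₀).trans (mul_le_mul_of_nonneg_left (exp_le_exp.2 (neg_le_neg (mul_le_mul_of_nonneg_right hνδ.le (hS0 b'))))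
      hc₁.le)
  -- termwise dominations by the no-loss convolution `e^{−μ|blk n p − b′|₁}e^{−ν|b′ − b₀|₁}`
  have hdom1 : ∀ b', |M b' b₀ * Ψ b' p| ≤ c₁ * (2 * CPK) * (exp (-(μ * ∑ i, (((blk n p i - b' i).natAbs : ℕ) : ℝ)))
      * exp (-(ν * ∑ i, (((b' i - b₀ i).natAbs : ℕ) : ℝ)))) := fun b' => by
    rw [abs_mul]
    calc |M b' b₀| * |Ψ b' p| ≤ (c₁ * exp (-(ν * ∑ i, (((b' i - b₀ i).natAbs : ℕ) : ℝ))))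
          * (2 * CPK * exp (-(μ * ∑ i, (((blk n p i - b' i).natAbs : ℕ) : ℝ)))) :=
          mul_le_mul (hMν b') (hA2 b' p) (abs_nonneg _) (by positivity)
      _ = _ := by ring
  have hdom2 : ∀ b', |N b' b₀ * ΨK b' p| ≤ 2 * CM * (2 * CPK) * (exp (-(μ * ∑ i, (((blk n p i - b' i).natAbs : ℕ) : ℝ)))
      * exp (-(ν * ∑ i, (((b' i - b₀ i).natAbs : ℕ) : ℝ)))) := fun b' => by
    rw [abs_mul]
    calc |N b' b₀| * |ΨK b' p| ≤ (2 * CM * exp (-(ν * ∑ i, (((b' i - b₀ i).natAbs : ℕ) : ℝ))))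
          * (2 * CPK * exp (-(μ * ∑ i, (((blk n p i - b' i).natAbs : ℕ) : ℝ)))) :=
          mul_le_mul (hC1 b' b₀) (hA4 b' p) (abs_nonneg _) (by positivity)
      _ = _ := by ring
  have hdom3 : ∀ b', |N b' b₀ * ΨK b' p - M b' b₀ * Ψ b' p| ≤ (2 * CM * TN * (2 * CPK) + c₁ * (4 * CPK * (CPK * Y)))
      * (exp (-(μ * ∑ i, (((blk n p i - b' i).natAbs : ℕ) : ℝ))) * exp (-(ν * ∑ i, (((b' i - b₀ i).natAbs : ℕ) : ℝ)))) := by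
    intro b'
    have e : N b' b₀ * ΨK b' p - M b' b₀ * Ψ b' p = (N b' b₀ - M b' b₀) * ΨK b' p + M b' b₀ * (ΨK b' p - Ψ b' p) := by ring
    rw [e]
    refine (abs_add_le _ _).trans ?_
    rw [abs_mul, abs_mul]
    calc |N b' b₀ - M b' b₀| * |ΨK b' p| + |M b' b₀| * |ΨK b' p - Ψ b' p|
        ≤ (2 * CM * TN * exp (-(ν * ∑ i, (((b' i - b₀ i).natAbs : ℕ) : ℝ))))
            * (2 * CPK * exp (-(μ * ∑ i, (((blk n p i - b' i).natAbs : ℕ) : ℝ))))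
          + (c₁ * exp (-(ν * ∑ i, (((b' i - b₀ i).natAbs : ℕ) : ℝ))))
            * (4 * CPK * (CPK * Y) * exp (-(μ * ∑ i, (((blk n p i - b' i).natAbs : ℕ) : ℝ)))) :=
          add_le_add (mul_le_mul (hC4 b' b₀) (hA4 b' p) (abs_nonneg _) (by positivity))
            (mul_le_mul (hMν b') (hA5 b' p) (abs_nonneg _) (by positivity))
      _ = _ := by ring
  obtain ⟨hcs, hcb⟩ := tsum_exp_conv_noLoss (d := d) hν.le hνμ b₀ (blk n p)
  have hs1 : Summable fun b' : X d => M b' b₀ * Ψ b' p :=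
    Summable.of_norm_bounded (hcs.mul_left (c₁ * (2 * CPK))) fun b' => by rw [Real.norm_eq_abs]; exact hdom1 b'
  have hs2 : Summable fun b' : X d => N b' b₀ * ΨK b' p :=
    Summable.of_norm_bounded (hcs.mul_left (2 * CM * (2 * CPK))) fun b' => by rw [Real.norm_eq_abs]; exact hdom2 b'
  refine ⟨hs1, hs2, ?_⟩
  rw [← hs2.tsum_sub hs1]
  have h1 : |∑' b' : X d, (N b' b₀ * ΨK b' p - M b' b₀ * Ψ b' p)| ≤ ∑' b' : X d, |N b' b₀ * ΨK b' p - M b' b₀ * Ψ b' p| := by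
    have := norm_tsum_le_tsum_norm (hs2.sub hs1).norm
    simpa only [Real.norm_eq_abs] using this
  have h2 := (hs2.sub hs1).abs.tsum_le_tsum hdom3 (hcs.mul_left _)
  rw [Summable.tsum_mul_left _ hcs] at h2
  have h3 := mul_le_mul_of_nonneg_left hcb (show 0 ≤ 2 * CM * TN * (2 * CPK) + c₁ * (4 * CPK * (CPK * Y)) by positivity)
  calc _ ≤ (2 * CM * TN * (2 * CPK) + c₁ * (4 * CPK * (CPK * Y))) * ((2 * (1 - exp (-(μ - ν)))⁻¹) ^ d
        * exp (-(ν * ∑ i, (((blk n p i - b₀ i).natAbs : ℕ) : ℝ)))) := h1.trans (h2.trans h3)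
    _ = _ := by ring

/-! ## §2. Toy -/

/-- Toy (`d = 3`, `a = 1`, `λ = 0`, `Λ = 1`): the five merged constants exist. -/
example : ∃ C₀ CP δ₀ c₁ δ₁ : ℝ, 0 < C₀ ∧ 0 < CP ∧ 0 < δ₀ ∧ 0 < c₁ ∧ 0 < δ₁ :=
  let ⟨C₀, CP, δ₀, c₁, δ₁, h1, h2, h3, h4, h5, _⟩ :=
    zd_perturbed_response_lipschitz (d := 3) le_rfl 1 one_pos (lam := 0) (Lam := 1)
      (by rw [min_eq_right (by norm_num : (1 : ℝ) ≤ 2)]; norm_num) zero_le_one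
  ⟨C₀, CP, δ₀, c₁, δ₁, h1, h2, h3, h4, h5⟩

end Summit.QuantumFields.BalabanUV.T4Continuum.NE7b.SupZdPerturbedResponseLipschitz
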